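import Summits.AnomalousDissipation.AnomalousDissipation.Theorems.GalerkinSteadyZerothLaw.Negative.StokesStates
import Literature.Analysis.FluidPDE.NSGalerkinStationary

/-!
# Tier B (continued) of the stub plan for `stub_loudCoatDecades` (line `idea-sketch-ideator2`),
# crux stmt-AnomalousDissipation-2986 (`MirrorVariety.GalerkinSteadyZerothLaw`): the coat's dissipation IS its production

`STUB-PLAN-stub_loudCoatDecades.md` §2.2 tier B, lemma B4 (k2-H4), the exact diagnostic identity behind kill criterion
K-3: for a SINGLE-SHELL exact Euler core `C` (`|k|² = n₀` on its support, `Π_N B(C, C) = 0`) and an amplitude-clamped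
coat `h ⊥ C` at clamp viscosity `ν` (real solenoidal, unforced residual of `C + h` collinear with `C`), the coat's own
dissipation equals the Reynolds-stress production on the core strain:
`ν‖∇h̃‖² = dissipation ν h = -∫ ⟪h̃, (h̃·∇)C̃⟫`, `h̃ = fieldOf N h`, `C̃ = fieldOf N C`.

Proof (`coat_dissipation_eq_production`).  Pair the coat equation `-νA c - Π B(c, c) = -s C` (`c = C + h`) with `h`
in `ℓ²`: the right side vanishes (`h ⊥ C`); the Stokes term gives `-ν·4π² ∑|k|² Re⟪c k, h k⟫ = -dissipation ν h`
(single shell: `∑|k|² Re⟪C k, h k⟫ = n₀ ∑ Re⟪C k, h k⟫ = 0`); the Leray symbol drops against the transversal `h k`;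
so `dissipation ν h = -∑ Re⟪B_N(c, c)_k, h k⟫ = -∫⟪(c̃·∇)c̃, h̃⟫` (Parseval against the band-limited `h̃`,
`mFourierCoeff_convect_realTrigPoly`).  Then the antisymmetry of the trilinear form for the divergence-free `c̃`
(`integral_inner_convect_eq_neg`, twice), `∫⟪h̃, (c̃·∇)h̃⟫ = 0`, additivity in the transporting field and the core's
exactness tested against `h̃` (`∫⟪(C̃·∇)C̃, h̃⟫ = ∑ Re⟪Π_k B_N(C, C)_k, h k⟫ = 0`) leave `-∫⟪h̃, (h̃·∇)C̃⟫`.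
The closing `stub_loudCoatProductionTools` is the REGISTERED one-conjunct packaging.  References: Temam,
*Navier–Stokes Equations* (1979/84), Ch. II §1.2 Lemma 1.3 (antisymmetry); Robinson–Rodrigo–Sadowski 2016, (4.5).
-/

noncomputable section

-- `Summit.<Summit>.<Problem>` is the tree's mandated summit-side namespace (CONVENTIONS §2); deliberate duplicate.
set_option linter.dupNamespace false

open scoped InnerProductSpace
open MeasureTheory Filter Set UnitAddTorus
open Literature.Analysis.FunctionSpaces Literature.Analysis.FunctionSpaces.Torus
open Literature.Analysis.FluidPDE Literature.Analysis.FluidPDE.Torus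

namespace Summit.AnomalousDissipation.AnomalousDissipation.Theorems.GalerkinSteadyZerothLaw

open Summit.AnomalousDissipation.AnomalousDissipation.Theorems.GalerkinSteadyZerothLaw.Negative (fieldOf)
open Summit.AnomalousDissipation.AnomalousDissipation.Theorems.LaminarNeverLoud.Negative
  (modes energy dissipation modes_symm)

/-- The field of a sum of coefficient vectors is the sum of the fields. [folklore] -/
theorem fieldOf_add {N : ℕ} (c c' : ↥(modes (Fin 3) N) → EuclideanSpace ℂ (Fin 3)) :
    fieldOf N (c + c') = fieldOf N c + fieldOf N c' := by
  unfold fieldOf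
  rw [coeffExt_add, realTrigPoly_add]

/-- **Core exactness tested against a coat**: if `Π_N B(C, C) = 0` (`galerkinRHS (modes N) 0 0 C = 0`) and `h` is real
solenoidal at level `N`, then `∫ ⟪(C̃·∇)C̃, h̃⟫ = 0` (Parseval against the band-limited `h̃`; the Leray symbol is
self-adjoint against the transversal `h k`). [folklore] -/
theorem integral_inner_convect_core_fieldOf {N : ℕ} {C h : ↥(modes (Fin 3) N) → EuclideanSpace ℂ (Fin 3)}
    (hC : C ∈ galerkinSubspace (modes (Fin 3) N)) (hcore : galerkinRHS (modes (Fin 3) N) 0 0 C = 0)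
    (hh : h ∈ galerkinSubspace (modes (Fin 3) N)) :
    ∫ x, ⟪convect (fieldOf N C) (fieldOf N C) x, fieldOf N h x⟫_ℝ = 0 := by
  have hS : ∀ k ∈ modes (Fin 3) N, -k ∈ modes (Fin 3) N := modes_symm N
  have hCb : IsConjSymm (coeffExt (modes (Fin 3) N) C) := hC.1.isConjSymm_coeffExt hS
  have hhb : IsConjSymm (coeffExt (modes (Fin 3) N) h) := hh.1.isConjSymm_coeffExt hS
  have hhT : IsTransversal (modes (Fin 3) N) (coeffExt (modes (Fin 3) N) h) := hh.2.isTransversal_coeffExt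
  have hCs : IsSmooth (fieldOf N C) := isSmooth_realTrigPoly _ _
  unfold fieldOf at hCs ⊢
  rw [integral_inner_realTrigPoly_right hS hhb ((hCs.convect hCs).memLp 2)]
  refine Finset.sum_eq_zero fun k hk => ?_
  rw [mFourierCoeff_convect_realTrigPoly hS hCb hCb, ← inner_leraySym_left_of_transversal _ _ (hhT k hk)]
  have h0 := congrFun hcore ⟨k, hk⟩
  rw [galerkinRHS_apply, galerkinField_def, coeffExt_zero, Pi.zero_apply, Pi.zero_apply, zero_sub, leraySym_neg]
    at h0
  simp only [zero_mul, Complex.ofReal_zero, zero_smul, neg_zero, zero_add, neg_eq_zero] at h0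
  rw [h0, inner_zero_left, Complex.zero_re]

/-- **B4 `coat_dissipation_eq_production`** (SINGLE-SHELL core; the exact diagnostic identity of kill criterion K-3).
For an exact Euler core `C` on one shell `|k|² = n₀` and a coat `h ⊥ C` at clamp viscosity `ν` (real solenoidal,
`galerkinRHS (modes N) ν 0 (C + h) = (-s) • C`), the coat's own dissipation IS the Reynolds-stress production on the
core strain: `dissipation ν h = -∫ ⟪h̃, (h̃·∇)C̃⟫`, `h̃ = fieldOf N h`, `C̃ = fieldOf N C`. [folklore] -/
theorem coat_dissipation_eq_production {N : ℕ} {n₀ ν s : ℝ} {C h : ↥(modes (Fin 3) N) → EuclideanSpace ℂ (Fin 3)}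
    (hC : C ∈ galerkinSubspace (modes (Fin 3) N)) (hcore : galerkinRHS (modes (Fin 3) N) 0 0 C = 0)
    (hshell : ∀ k : ↥(modes (Fin 3) N), C k ≠ 0 → freqNormSq (k : Fin 3 → ℤ) = n₀)
    (hh : h ∈ galerkinSubspace (modes (Fin 3) N)) (horth : (∑ k, (inner ℂ (C k) (h k)).re) = 0)
    (hs : galerkinRHS (modes (Fin 3) N) ν 0 (C + h) = (-s) • C) :
    dissipation ν h = -∫ x, ⟪fieldOf N h x, convect (fieldOf N h) (fieldOf N C) x⟫_ℝ := by
  have hS : ∀ k ∈ modes (Fin 3) N, -k ∈ modes (Fin 3) N := modes_symm N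
  have hc : C + h ∈ galerkinSubspace (modes (Fin 3) N) := (galerkinSubspace (modes (Fin 3) N)).add_mem hC hh
  have hcb : IsConjSymm (coeffExt (modes (Fin 3) N) (C + h)) := hc.1.isConjSymm_coeffExt hS
  have hhb : IsConjSymm (coeffExt (modes (Fin 3) N) h) := hh.1.isConjSymm_coeffExt hS
  have hcT : IsTransversal (modes (Fin 3) N) (coeffExt (modes (Fin 3) N) (C + h)) := hc.2.isTransversal_coeffExt
  -- smoothness / incompressibility of the fields
  have hCs : IsSmooth (fieldOf N C) := isSmooth_realTrigPoly _ _
  have hhs : IsSmooth (fieldOf N h) := isSmooth_realTrigPoly _ _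
  have hcs : IsSmooth (fieldOf N (C + h)) := isSmooth_realTrigPoly _ _
  have hdivc : IsDivFree (fieldOf N (C + h)) := isDivFree_realTrigPoly hcT
  -- ### Step 1 (coefficients): `dissipation ν h = -∑ Re⟪B_N(c, c)_k, h k⟫`
  have hpt : ∀ k : ↥(modes (Fin 3) N), (inner ℂ (galerkinRHS (modes (Fin 3) N) ν 0 (C + h) k) (h k)).re =
      -(ν * (4 * Real.pi ^ 2 * freqNormSq (k : Fin 3 → ℤ))) * (inner ℂ ((C + h) k) (h k)).re -
        (inner ℂ (convectionCoeff (modes (Fin 3) N) (coeffExt (modes (Fin 3) N) (C + h))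
          (coeffExt (modes (Fin 3) N) (C + h)) k) (h k)).re := by
    intro k
    rw [galerkinRHS_apply, galerkinField_def, coeffExt_zero, Pi.zero_apply, zero_sub, coeffExt_coe, inner_add_left,
      Complex.add_re, inner_neg_left, Complex.neg_re, inner_leraySym_left_of_transversal _ _ (hh.2 k),
      inner_neg_left, Complex.neg_re, inner_smul_left, Complex.conj_ofReal, Complex.re_ofReal_mul]
    ring
  have hsumR : ∑ k : ↥(modes (Fin 3) N), (inner ℂ (((-s) • C) k) (h k)).re = 0 := by
    have e : ∀ k : ↥(modes (Fin 3) N), (inner ℂ (((-s) • C) k) (h k)).re = -s * (inner ℂ (C k) (h k)).re := by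
      intro k
      have e1 : ((-s) • C) k = Complex.ofReal (-s) • C k := by
        rw [Pi.smul_apply, RCLike.real_smul_eq_coe_smul (K := ℂ)]
        rfl
      rw [e1, inner_smul_left, Complex.conj_ofReal, Complex.re_ofReal_mul]
    rw [Finset.sum_congr rfl fun k _ => e k, ← Finset.mul_sum, horth, mul_zero]
  -- single shell: the Stokes pairing is the coat's dissipation
  have hstokes : ∑ k : ↥(modes (Fin 3) N),
      ν * (4 * Real.pi ^ 2 * freqNormSq (k : Fin 3 → ℤ)) * (inner ℂ ((C + h) k) (h k)).re = dissipation ν h := by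
    have e : ∀ k : ↥(modes (Fin 3) N), ν * (4 * Real.pi ^ 2 * freqNormSq (k : Fin 3 → ℤ)) * (inner ℂ ((C + h) k) (h k)).re
        = ν * (4 * Real.pi ^ 2) * (n₀ * (inner ℂ (C k) (h k)).re) +
          ν * (4 * Real.pi ^ 2) * (freqNormSq (k : Fin 3 → ℤ) * ‖h k‖ ^ 2) := by
      intro k
      have hhh : (inner ℂ (h k) (h k)).re = ‖h k‖ ^ 2 := inner_self_eq_norm_sq (𝕜 := ℂ) (h k)
      have hsh : freqNormSq (k : Fin 3 → ℤ) * (inner ℂ (C k) (h k)).re = n₀ * (inner ℂ (C k) (h k)).re := by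
        by_cases hk : C k = 0
        · rw [hk, inner_zero_left, Complex.zero_re, mul_zero, mul_zero]
        · rw [hshell k hk]
      rw [Pi.add_apply, inner_add_left, Complex.add_re, hhh, ← hsh]
      ring
    rw [Finset.sum_congr rfl fun k _ => e k, Finset.sum_add_distrib, ← Finset.mul_sum, ← Finset.mul_sum,
      ← Finset.mul_sum, horth, mul_zero, mul_zero, zero_add]
    unfold dissipation
    ring
  have hstep1 : dissipation ν h = -∑ k : ↥(modes (Fin 3) N),
      (inner ℂ (convectionCoeff (modes (Fin 3) N) (coeffExt (modes (Fin 3) N) (C + h))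
        (coeffExt (modes (Fin 3) N) (C + h)) k) (h k)).re := by
    have hsum := hsumR
    rw [← hs, Finset.sum_congr rfl fun k _ => hpt k, Finset.sum_sub_distrib] at hsum
    have hneg : ∑ k : ↥(modes (Fin 3) N),
        -(ν * (4 * Real.pi ^ 2 * freqNormSq (k : Fin 3 → ℤ))) * (inner ℂ ((C + h) k) (h k)).re = -dissipation ν h := by
      rw [← hstokes, ← Finset.sum_neg_distrib]
      refine Finset.sum_congr rfl fun k _ => ?_
      ring
    rw [hneg] at hsum
    linarith
  -- ### Step 2 (Parseval against the band-limited `h̃`): the sum is `∫ ⟪(c̃·∇)c̃, h̃⟫`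
  have hstep2 : ∑ k : ↥(modes (Fin 3) N),
      (inner ℂ (convectionCoeff (modes (Fin 3) N) (coeffExt (modes (Fin 3) N) (C + h))
        (coeffExt (modes (Fin 3) N) (C + h)) k) (h k)).re =
      ∫ x, ⟪convect (fieldOf N (C + h)) (fieldOf N (C + h)) x, fieldOf N h x⟫_ℝ := by
    unfold fieldOf at hcs ⊢
    rw [integral_inner_realTrigPoly_right hS hhb ((hcs.convect hcs).memLp 2),
      ← sum_coeffExt (fun k v => (inner ℂ (convectionCoeff (modes (Fin 3) N) (coeffExt (modes (Fin 3) N) (C + h))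
        (coeffExt (modes (Fin 3) N) (C + h)) k) v).re) h]
    refine Finset.sum_congr rfl fun k _ => ?_
    rw [mFourierCoeff_convect_realTrigPoly hS hcb hcb]
  -- ### Step 3 (fields): antisymmetry of the trilinear form and the core's exactness
  -- `∫⟪(c̃·∇)c̃, h̃⟫ = -∫⟪c̃, (c̃·∇)h̃⟫`
  have hI1 := integral_inner_convect_eq_neg hcs hdivc hcs hhs
  -- `∫⟪c̃, (c̃·∇)h̃⟫ = ∫⟪C̃, (c̃·∇)h̃⟫ + ∫⟪h̃, (c̃·∇)h̃⟫`
  have hI2 : ∫ x, ⟪fieldOf N (C + h) x, convect (fieldOf N (C + h)) (fieldOf N h) x⟫_ℝ =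
      (∫ x, ⟪fieldOf N C x, convect (fieldOf N (C + h)) (fieldOf N h) x⟫_ℝ) +
        ∫ x, ⟪fieldOf N h x, convect (fieldOf N (C + h)) (fieldOf N h) x⟫_ℝ := by
    rw [← integral_add (hCs.inner (hcs.convect hhs)).integrable (hhs.inner (hcs.convect hhs)).integrable]
    refine integral_congr_ae (ae_of_all _ fun x => ?_)
    show ⟪fieldOf N (C + h) x, convect (fieldOf N (C + h)) (fieldOf N h) x⟫_ℝ =
      ⟪fieldOf N C x, convect (fieldOf N (C + h)) (fieldOf N h) x⟫_ℝ +
        ⟪fieldOf N h x, convect (fieldOf N (C + h)) (fieldOf N h) x⟫_ℝ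
    rw [fieldOf_add, Pi.add_apply, inner_add_left]
  -- `∫⟪h̃, (c̃·∇)h̃⟫ = 0`
  have hI3 : ∫ x, ⟪fieldOf N h x, convect (fieldOf N (C + h)) (fieldOf N h) x⟫_ℝ = 0 := by
    have h2 := integral_inner_convect_add_eq_zero hcs hdivc hhs hhs
    have hsym : ∫ x, ⟪convect (fieldOf N (C + h)) (fieldOf N h) x, fieldOf N h x⟫_ℝ =
        ∫ x, ⟪fieldOf N h x, convect (fieldOf N (C + h)) (fieldOf N h) x⟫_ℝ :=
      integral_congr_ae (ae_of_all _ fun x => real_inner_comm _ _)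
    rw [hsym] at h2
    linarith
  -- `∫⟪(c̃·∇)C̃, h̃⟫ = -∫⟪C̃, (c̃·∇)h̃⟫`
  have hI4 := integral_inner_convect_eq_neg hcs hdivc hCs hhs
  -- `∫⟪(c̃·∇)C̃, h̃⟫ = ∫⟪(C̃·∇)C̃, h̃⟫ + ∫⟪(h̃·∇)C̃, h̃⟫`
  have hI5 : ∫ x, ⟪convect (fieldOf N (C + h)) (fieldOf N C) x, fieldOf N h x⟫_ℝ =
      (∫ x, ⟪convect (fieldOf N C) (fieldOf N C) x, fieldOf N h x⟫_ℝ) +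
        ∫ x, ⟪convect (fieldOf N h) (fieldOf N C) x, fieldOf N h x⟫_ℝ := by
    rw [← integral_add ((hCs.convect hCs).inner hhs).integrable ((hhs.convect hCs).inner hhs).integrable]
    refine integral_congr_ae (ae_of_all _ fun x => ?_)
    have hadd : convect (fieldOf N (C + h)) (fieldOf N C) x =
        convect (fieldOf N C) (fieldOf N C) x + convect (fieldOf N h) (fieldOf N C) x := by
      show Torus.fderiv (fieldOf N C) x (fieldOf N (C + h) x) =
        Torus.fderiv (fieldOf N C) x (fieldOf N C x) + Torus.fderiv (fieldOf N C) x (fieldOf N h x)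
      rw [fieldOf_add, Pi.add_apply, map_add]
    show ⟪convect (fieldOf N (C + h)) (fieldOf N C) x, fieldOf N h x⟫_ℝ =
      ⟪convect (fieldOf N C) (fieldOf N C) x, fieldOf N h x⟫_ℝ + ⟪convect (fieldOf N h) (fieldOf N C) x, fieldOf N h x⟫_ℝ
    rw [hadd, inner_add_left]
  -- `∫⟪(C̃·∇)C̃, h̃⟫ = 0` (core exactness) and `∫⟪(h̃·∇)C̃, h̃⟫ = ∫⟪h̃, (h̃·∇)C̃⟫`
  have hI6 := integral_inner_convect_core_fieldOf hC hcore hh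
  have hI7 : ∫ x, ⟪convect (fieldOf N h) (fieldOf N C) x, fieldOf N h x⟫_ℝ =
      ∫ x, ⟪fieldOf N h x, convect (fieldOf N h) (fieldOf N C) x⟫_ℝ :=
    integral_congr_ae (ae_of_all _ fun x => real_inner_comm _ _)
  -- assemble
  rw [hstep1, hstep2, hI1, hI2, hI3, add_zero, neg_neg]
  linarith [hI4, hI5, hI6, hI7]

/-- **stub_loudCoatProductionTools** (REGISTERED sub-goal of the line `idea-sketch-ideator2`: tier B of the stub plan
for `stub_loudCoatDecades`, lemma B4).  Packaging of `coat_dissipation_eq_production`. [folklore] -/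
theorem stub_loudCoatProductionTools : ∀ (N : ℕ) (n₀ ν s : ℝ) (C h : ↥(modes (Fin 3) N) → EuclideanSpace ℂ (Fin 3)), C ∈ galerkinSubspace (modes (Fin 3) N) → galerkinRHS (modes (Fin 3) N) 0 0 C = 0 → (∀ k : ↥(modes (Fin 3) N), C k ≠ 0 → freqNormSq (k : Fin 3 → ℤ) = n₀) → h ∈ galerkinSubspace (modes (Fin 3) N) → (∑ k, (inner ℂ (C k) (h k)).re) = 0 → galerkinRHS (modes (Fin 3) N) ν 0 (C + h) = (-s) • C → dissipation ν h = -∫ x, ⟪fieldOf N h x, convect (fieldOf N h) (fieldOf N C) x⟫_ℝ :=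
  fun _ _ _ _ _ _ hC hcore hshell hh horth hs => coat_dissipation_eq_production hC hcore hshell hh horth hs

end Summit.AnomalousDissipation.AnomalousDissipation.Theorems.GalerkinSteadyZerothLaw

end

-- buildfix 2026-08-20 (ops-buildfix-1 gen 7): enqueue-only re-land — rebuild after B-35 (StokesArc, p233893) healed this module's import closure; no declaration changed.
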